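import Literature.AlgebraicGeometry.HodgeTheory.CodimTwoDivisorWeilGenerated
import Literature.AlgebraicGeometry.HodgeTheory.UnitaryTypeOneTimesCMCurveProductSpan
import Literature.AlgebraicGeometry.HodgeTheory.TimesLowGenericProductSpan
import Literature.AlgebraicGeometry.HodgeTheory.HodgeClassesProductSpanTransport
import Literature.AlgebraicGeometry.HodgeTheory.CurveTimesSimpleSurfaceStablyNondegenerate
import Literature.AlgebraicGeometry.HodgeTheory.DivisorClassesHardLefschetz
import Literature.AlgebraicGeometry.Motives.AbelianVarietyImageSimpleProofs
import Literature.AlgebraicGeometry.HodgeTheory.AbelianVarietyHOneHomMultiplicityFormula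
import HarnessLib

/-!
# `B²(X) ⊆ D²(X) + Σ_α α^* B²(X')` pointwise: the codimension-2 conclusion of Moonen–Zarhin's Thm. 0.2 (fivefolds) as a
# predicate on one complex abelian variety, its isogeny invariance, the Künneth row `Y × C`, and the rows of the
# NON-SIMPLE fivefolds the tree has proved (Thm. 0.2 (2) case (f), (3) case (g) with `End⁰ = k`, (4) with a fourfold factor)

Ring 2 literature lane (cell `pub-hodge-ring2`, lit gen 64, programme R38). HONEST FRAMING (cell, verbatim): research
route conditional on HC_CM; not a corollary; Q11.4-sentence-2 already refuted in dim ≥ 3. `HC_CM` does not occur in this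
file; Markman's theorem and the fourfold fact occur only as HYPOTHESES of §1's last theorem. One definition with body (a
predicate), theorems; no named fact, no `sorry`. Companion of `HodgeTheory/CodimTwoDivisorWeilGenerated` (R37, the
fourfold fact pointwise).

THE PRINT. B. Moonen, Yu. Zarhin, *Hodge classes on abelian varieties of low dimension*, Math. Ann. **315** (1999)
711–733 [held: `paper:arxiv-math_9901113`], Thm. 0.2 (dimension `5`): «(1) [case (e), `X ∼ X₁² × X₂`] … `B•(X)` is
generated by the subalgebra `D•(X)` of divisor classes together with the subspaces `W_{k,α}` [the image of
`W_k ⊂ B²(X_1 × X_2)` under the map induced by a surjective homomorphism `α : X → X_1 × X_2`] … (2) [case (f)] …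
`Hg(X) = Hg(X_0) × Hg(X_1 × X_2)` … (3) [case (g)] `B•(X) = D•(X)` … (4) Suppose we are not in one of the cases (e), (f)
or (g). … Then `Hg(X) = Hg(Y₁^{m₁}) × ⋯ × Hg(Y_r^{m_r})`» (chunks p0001–p0002), proved in §5 (5.6)–(5.12)
(chunks p0009–p0011): the Künneth decomposition `H⁴(E × Y) = [H²⊗H²] ⊕ [H¹⊗H³] ⊕ [H⁰⊗H⁴]` (p0009 L28–L31).

THE TREE'S NAMED FACT `MoonenZarhin1999_codimTwoHodgeClasses_abelianFivefold`
(`HodgeTheory/AbelianLowDimensionCodimTwoHodgeClasses`) is the codimension-`2` reading of Thm. 0.2 for ALL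
fivefolds, in the WEAK pull-back form «`B²(X) = D²(X) + Σ_α α^* B²(X')`» (Thm. 0.2 (1)–(4); §5 (5.12)): every rational
`(2,2)`-class lies in `D²(A) ⊗ ℂ ⊔ span_ℂ {α^* w : α : A ⟶ B a SURJECTIVE homomorphism onto an abelian FOURFOLD B,
w a rational (2,2)-class on B}`. This file types that conclusion AT ONE `A` as the predicate
`IsCodimTwoDivisorPullbackGenerated A` (same body, `A` free; the fact is `∀ A, dim A = 5 → …` by `Iff.rfl`) and records
the rows the tree has PROVED:

* §1 `IsDivisorGenerated.isCodimTwoDivisorPullbackGenerated` (`B = D`), and the HC READING for a FIVEFOLD: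
  **`IsCodimTwoDivisorPullbackGenerated.hodgeConjectureFor_of_fourfolds`** — the predicate plus «every rational
  `(2,2)`-class on every abelian fourfold is algebraic» give the Hodge conjecture for `A` (pull-backs of algebraic
  classes along homomorphisms of abelian varieties are algebraic, the tree's theorem
  `map_mem_algebraicClasses_of_abelianVariety`; Lefschetz `(1,1)`; hard Lefschetz); with the fourfold input supplied
  by the fourfold fact + Markman's theorem (hypotheses): `…_of_markman_of_fourfoldFact` — the pointwise form of the
  tree's `MoonenZarhin1999_hodgeClasses_abelian_dim_le_five_of_weilClassesFourfolds_of_printed`.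
* §2 ISOGENY INVARIANCE `IsCodimTwoDivisorPullbackGenerated.of_isIsogeny` / `'` / `of_isIsogenous` / `'` / `iff`
  («Up to isogeny», (5.1); van Geemen 3.6–3.7; `f^* α^* = (f ≫ α)^*` with `f ≫ α` again surjective — NO transport
  of structure is needed in the weak form).
* §3 THE KÜNNETH ROW: **`isCodimTwoDivisorPullbackGenerated_prod_curve_of_productSpan`** — for `Y` a FOURFOLD, `C` an
  elliptic curve and `HodgeClassesProductSpan Y C` («`Hg(Y × C) = Hg(Y) × Hg(C)`» read on classes), `Y × C` satisfies
  the predicate: a generator `pr_Y^* a ∪ pr_C^* b` has `(deg a, deg b) = (4,0)` — `b ∈ H⁰(C) = ℂ·1`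
  (`mem_divisorClassesSpan_zero`), so it is a multiple of `pr_Y^* a`, the pull-back of a rational `(2,2)`-class of
  the fourfold `Y` along the surjective `pr_Y` —, `(2,2)` — a product of two divisor classes —, or `(0,4)` —
  `b ∈ H⁴(C) = 0`. Also `C × Y`.
* §4 ROWS: case (f) `isCodimTwoDivisorPullbackGenerated_caseF` (`X₀ × (X₁ × X₂)`, `X₀ ≁ X₁` curves, `X₂` a simple
  threefold, `j : End⁰(X₁) →+* End⁰(X₂)`: product span = the tree's R33-B `hodgeClassesProductSpan_caseF_of_dim_eq_three`
  fed from `j`) and `…_of_isIsogenous_caseF`; `Y × C` with `Y` a simple fourfold: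
  `…_fourfold_prod_curve_of_finrank_eq_one` (`End⁰(C) = ℚ`, Lemma (3.4)), `…_simpleFourfold_prod_cmCurve_of_balanced`
  (Prop. (3.8) / (5.11) Case 1 and the no-embedding case, the tree's R31-B
  `hodgeClassesProductSpan_of_isSimple_cmCurve_of_balanced`), `…_fourfold_prod_cmCurve_of_unitaryTypeOne` (case (g)
  with `End⁰(Y) = k`: `B = D`, the tree's R29 `isDivisorGenerated_prod_cmCurve_of_unitaryTypeOne`), assembled in
  **`isCodimTwoDivisorPullbackGenerated_simpleFourfold_prod_curve`**: `Y × C` satisfies the predicate UNLESS `C` is of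
  CM type with `χ ≫ χ = -d'` and `Y` carries a CENTRAL `φ`, `φ ≫ φ = -(M²d')`, of UNBALANCED multiplicities, with
  `dim_ℚ End⁰(Y) ≠ 2` — the residual of case (g) («`k ↪ End⁰(X₂)` acting `(1,3)`» with `End⁰(X₂) ⊋ k`); isogenous `X`.

What is NOT here: case (e) (Thm. 0.2 (1): two pull-backs `W_{k,α₁}`, `W_{k,α₂}`); case (g) with `End⁰(X₂) ⊋ k`; the
simple fivefolds (Tankeev–Ribet, a named fact of the tree); the CM fivefolds as such; the census over all non-simple
fivefolds (Summit-side, `Summits/HodgeConjecture/Ring2/NonSimpleFivefoldsCodimTwo`, which needs the cell's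
`NonSimpleFivefoldsComplete`). The named fact is NOT discharged.

## References
* [MoonenZarhin1999LowDim] B. Moonen, Yu. Zarhin, Math. Ann. 315 (1999) 711–733, Thm. 0.2 (1)–(4), §3 Lemma
  (3.4), Prop. (3.8), §5 (5.1), (5.6)–(5.12) (item numbers as printed in arXiv:math/9901113v2; the paper has no
  item (2.8)).
* [vanGeemen1994HodgeAV] B. van Geemen, LNM 1594 (1994), 2.4, 3.6–3.7.
* [MumfordAV1970] D. Mumford, *Abelian Varieties* (1970), §19 Remark p. 169, Thm. 1 and Cor. 2 (pp. 173–174).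
* [HatcherAT2002] A. Hatcher, *Algebraic Topology* (2002), §3.2 Prop. 3.10, p. 211 (`f^* 1 = 1`, `a ∪ 1 = a`).
* [Fulton1998] W. Fulton, *Intersection Theory*, §19.2 Cor. 19.2 (b) (pull-back of algebraic classes).
* [Markman2025SurveySecant] E. Markman, arXiv:2509.23403, §1.1 and Cor. 1.3 (hypothesis only).
* [VoisinHodgeI2002] C. Voisin, *Hodge Theory and Complex Algebraic Geometry I*, Thm. 6.25, Thm. 11.30.
-/

noncomputable section

open CategoryTheory AlgebraicGeometry Module MonoidalCategory CartesianMonoidalCategory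

namespace Literature.AlgebraicGeometry.HodgeTheory

open Literature.AlgebraicTopology.SingularHomology
open Literature.AlgebraicGeometry.Motives (AbelianVariety IsSmoothProjective ComplexPoints
  abelianVarietyCohomologyExteriorH1_holds)
open Literature.AlgebraicGeometry.Motives.AbelianVariety
open Literature.AlgebraicGeometry.Milne1999 (IsOfCMType surjective_toSchemeHom_of_comp_eq_nsmul_id)
open Literature.Barriers.HodgeConjecture (divisorClassesSpan divisorMonomials mem_divisorMonomials_zero)

variable {A B X Y C E X₀ X₁ X₂ : AbelianVariety ℂ}

/-! ### §0 The predicate -/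

/-- **`IsCodimTwoDivisorPullbackGenerated A` — `B²(A) ⊆ D²(A) + Σ_α α^* B²(A')` on the tree's real carriers**: every
rational class of Hodge type `(2,2)` in `H⁴(A(ℂ); ℂ)` lies in the span of the complexified products of divisor
classes `divisorClassesSpan A.X A.dim 2` and of the pull-backs `α^* w = complexBetti.map α (2*2) w` of rational
`(2,2)`-classes `w` on abelian FOURFOLDS `A'` along the SURJECTIVE homomorphisms `α : A ⟶ A'` (Moonen–Zarhin Thm. 0.2
(1)–(4), §5 (5.12): «`B²(X) = D²(X) + Σ_α α^* B²(X')`»). VERBATIM the body of the tree's named fact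
`MoonenZarhin1999_codimTwoHodgeClasses_abelianFivefold` with the abelian variety free (that fact is
`∀ A, A.dim = 5 → IsCodimTwoDivisorPullbackGenerated A`, `moonenZarhin1999_codimTwoHodgeClasses_abelianFivefold_iff`);
a predicate (nothing asserted). [cite: MoonenZarhin1999LowDim, Thm. 0.2 (1)–(4) and §5 (5.12)] -/
def IsCodimTwoDivisorPullbackGenerated (A : AbelianVariety ℂ) : Prop :=
  ∀ c : complexBetti A.X (2 * 2), IsRationalClass c → IsOfHodgeType A.dim A.X (2 * 2) 2 2 c →
    c ∈ divisorClassesSpan A.X A.dim 2 ⊔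
      Submodule.span ℂ {w' : complexBetti A.X (2 * 2) |
        ∃ (B : AbelianVariety ℂ) (α : A ⟶ B) (w : complexBetti B.X (2 * 2)),
          B.dim = 4 ∧ Surjective (AbelianVariety.Hom.toSchemeHom α) ∧
          IsRationalClass w ∧ IsOfHodgeType B.dim B.X (2 * 2) 2 2 w ∧
          w' = complexBetti.map α.hom.hom.hom (2 * 2) w}

/-- Unfolding of `IsCodimTwoDivisorPullbackGenerated`. [cite: MoonenZarhin1999LowDim, Thm. 0.2 (1)–(4)] -/
theorem isCodimTwoDivisorPullbackGenerated_iff (A : AbelianVariety ℂ) :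
    IsCodimTwoDivisorPullbackGenerated A ↔
      ∀ c : complexBetti A.X (2 * 2), IsRationalClass c → IsOfHodgeType A.dim A.X (2 * 2) 2 2 c →
        c ∈ divisorClassesSpan A.X A.dim 2 ⊔
          Submodule.span ℂ {w' : complexBetti A.X (2 * 2) |
            ∃ (B : AbelianVariety ℂ) (α : A ⟶ B) (w : complexBetti B.X (2 * 2)),
              B.dim = 4 ∧ Surjective (AbelianVariety.Hom.toSchemeHom α) ∧
              IsRationalClass w ∧ IsOfHodgeType B.dim B.X (2 * 2) 2 2 w ∧
              w' = complexBetti.map α.hom.hom.hom (2 * 2) w} :=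
  Iff.rfl

/-- **The named fact `MoonenZarhin1999_codimTwoHodgeClasses_abelianFivefold` is `IsCodimTwoDivisorPullbackGenerated`
at every fivefold** (definitional). [cite: MoonenZarhin1999LowDim, Thm. 0.2 (1)–(4) and §5 (5.12)] -/
theorem moonenZarhin1999_codimTwoHodgeClasses_abelianFivefold_iff :
    MoonenZarhin1999_codimTwoHodgeClasses_abelianFivefold ↔
      ∀ A : AbelianVariety ℂ, A.dim = 5 → IsCodimTwoDivisorPullbackGenerated A :=
  Iff.rfl

/-- The fact, granted as a hypothesis, gives the predicate at every fivefold. [cite: MoonenZarhin1999LowDim, Thm. 0.2] -/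
theorem isCodimTwoDivisorPullbackGenerated_of_dim_eq_five_of_fact
    (h : MoonenZarhin1999_codimTwoHodgeClasses_abelianFivefold) (hA : A.dim = 5) :
    IsCodimTwoDivisorPullbackGenerated A :=
  h A hA

/-! ### §1 The row `B = D`; the Hodge conjecture for a fivefold from the predicate and the fourfolds -/

/-- **`B = D` gives `B² ⊆ D² + Σ_α α^* B²(X')`** (the pull-back summand is not needed): Thm. 0.2 (3), (4)
(«`B•(X) = D•(X)`», «`B•(Xⁿ) = D•(Xⁿ)`»). [cite: MoonenZarhin1999LowDim, Thm. 0.2 (3)–(4)] [cite: vanGeemen1994HodgeAV, §2.4] -/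
theorem IsDivisorGenerated.isCodimTwoDivisorPullbackGenerated (h : IsDivisorGenerated A) :
    IsCodimTwoDivisorPullbackGenerated A :=
  fun c hc hH => Submodule.mem_sup_left (h 2 c hc hH)

/-- A stably nondegenerate abelian variety satisfies `B² ⊆ D² + Σ_α α^* B²(X')`.
[cite: MoonenZarhin1999LowDim, Thm. 0.2 (4) and §2 condition (D)] -/
theorem IsStablyNondegenerate.isCodimTwoDivisorPullbackGenerated (h : IsStablyNondegenerate A) :
    IsCodimTwoDivisorPullbackGenerated A :=
  h.isDivisorGenerated.isCodimTwoDivisorPullbackGenerated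

/-- **CODIMENSION 2 ON `A` FROM THE PREDICATE AND THE FOURFOLDS**: if `B²(A) ⊆ D² + Σ_α α^* B²(A')` and every rational
`(2,2)`-class on every abelian FOURFOLD is algebraic, then every rational `(2,2)`-class on `A` is algebraic — divisor
products are algebraic (Lefschetz `(1,1)`, the tree's `lefschetzOneOne_rational_holds`, and
`AbelianVariety.divisorClassesSpan_le_algebraicClasses`), and pull-backs of algebraic classes along homomorphisms of
abelian varieties are algebraic (the tree's `map_mem_algebraicClasses_of_abelianVariety`: move by a general translate,
no moving lemma). [cite: MoonenZarhin1999LowDim, Thm. 0.2 (1)–(4)] [cite: Fulton1998, §19.2 Cor. 19.2 (b)]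
[cite: Markman2025SurveySecant, §1.1 (before Cor. 1.3)] -/
theorem IsCodimTwoDivisorPullbackGenerated.mem_algebraicClasses_two (h : IsCodimTwoDivisorPullbackGenerated A)
    (h4 : ∀ B : AbelianVariety ℂ, B.dim = 4 → ∀ w : complexBetti B.X (2 * 2), IsRationalClass w →
      IsOfHodgeType B.dim B.X (2 * 2) 2 2 w → w ∈ algebraicClasses B.X 2)
    {c : complexBetti A.X (2 * 2)} (hc : IsRationalClass c) (hH : IsOfHodgeType A.dim A.X (2 * 2) 2 2 c) :
    c ∈ algebraicClasses A.X 2 := by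
  have hX : IsSmoothProjective A.dim A.X := AbelianVariety.isSmoothProjective_holds
  refine (sup_le (AbelianVariety.divisorClassesSpan_le_algebraicClasses A
    (fun b hb hb' => lefschetzOneOne_rational_holds hX b hb hb') 2) (Submodule.span_le.2 ?_)) (h c hc hH)
  rintro w' ⟨B, α, w, hB, -, hwQ, hwH, rfl⟩
  exact map_mem_algebraicClasses_of_abelianVariety hX B α.hom.hom.hom (h4 B hB w hwQ hwH)

/-- **THE HODGE CONJECTURE FOR A FIVEFOLD WITH `B² ⊆ D² + Σ_α α^* B²(X')`, GRANTED THE RATIONAL `(2,2)`-CLASSES OF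
ALL ABELIAN FOURFOLDS** (hypothesis `h4`): codimension `0`, `1` (Lefschetz `(1,1)`), `2` (previous theorem), `3, 4, 5`
(hard Lefschetz, the tree's theorem `nonempty_hardLefschetzNFold_holds`). [cite: MoonenZarhin1999LowDim, Thm. 0.2]
[cite: VoisinHodgeI2002, Thm. 6.25 and Thm. 11.30] -/
theorem IsCodimTwoDivisorPullbackGenerated.hodgeConjectureFor_of_fourfolds (hA : A.dim = 5)
    (h : IsCodimTwoDivisorPullbackGenerated A)
    (h4 : ∀ B : AbelianVariety ℂ, B.dim = 4 → ∀ w : complexBetti B.X (2 * 2), IsRationalClass w →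
      IsOfHodgeType B.dim B.X (2 * 2) 2 2 w → w ∈ algebraicClasses B.X 2) :
    HodgeConjectureFor A.dim A.X := by
  have hX : IsSmoothProjective A.dim A.X := AbelianVariety.isSmoothProjective_holds
  refine ⟨nonempty_hodgeModel_holds hX, fun p c hc hpp => ?_⟩
  -- the half `2q ≤ dim A`: codimension zero, Lefschetz `(1,1)`, and the codimension-`2` row
  have low : ∀ (q : ℕ) (c : complexBetti A.X (2 * q)), 2 * q ≤ A.dim → IsRationalClass c →
      IsOfHodgeType A.dim A.X (2 * q) q q c → c ∈ algebraicClasses A.X q := by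
    intro q c hq hc hqq
    have hq2 : q ≤ 2 := by omega
    interval_cases q
    · exact hodgeConjectureFor_codim_zero c
    · exact lefschetzOneOne_rational_holds hX c hc hqq
    · exact h.mem_algebraicClasses_two h4 hc hqq
  rcases Nat.lt_or_ge A.dim (2 * p) with hlt | hge
  · exact mem_algebraicClasses_of_lt_of_nonempty (nonempty_hardLefschetzNFold_holds _ _) hX hlt
      (fun c' hc' hpp' ↦ low (A.dim - p) c' (by omega) hc' hpp') c hc hpp
  · exact low p c hge hc hpp

/-- **THE HODGE CONJECTURE FOR A FIVEFOLD WITH `B² ⊆ D² + Σ_α α^* B²(X')`, GRANTED MARKMAN'S THEOREM AND THE FOURFOLD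
FACT** (both named facts of the tree taken as HYPOTHESES: `Markman2025_weilClasses_algebraic_abelianFourfold` and
`MoonenZarhin1999_codimTwoHodgeClasses_abelianFourfold`; the latter supplies `B² ⊆ D² + Σ W_K` on the fourfold targets,
the tree's `mem_algebraicClasses_two_of_dim_eq_four` their algebraicity) — the pointwise form of the tree's reduction
`MoonenZarhin1999_hodgeClasses_abelian_dim_le_five_of_weilClassesFourfolds_of_printed` at one fivefold.
[cite: MoonenZarhin1999LowDim, Thm. 0.1 and Thm. 0.2] [cite: Markman2025SurveySecant, §1.1 and Cor. 1.3] -/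
theorem IsCodimTwoDivisorPullbackGenerated.hodgeConjectureFor_of_markman_of_fourfoldFact (hA : A.dim = 5)
    (h : IsCodimTwoDivisorPullbackGenerated A) (hMark : Markman2025_weilClasses_algebraic_abelianFourfold)
    (h4 : MoonenZarhin1999_codimTwoHodgeClasses_abelianFourfold) : HodgeConjectureFor A.dim A.X :=
  h.hodgeConjectureFor_of_fourfolds hA fun B hB w hwQ hwH =>
    mem_algebraicClasses_two_of_dim_eq_four hMark B hB
      (fun b hb hb' => lefschetzOneOne_rational_holds AbelianVariety.isSmoothProjective_holds b hb hb') (h4 B hB w hwQ hwH)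

/-! ### §2 Isogeny invariance («Up to isogeny», (5.1); van Geemen 3.6–3.7) -/

/-- **`B² ⊆ D² + Σ_α α^* B²(X')` PASSES TO THE SOURCE OF AN ISOGENY.** For an isogeny `f : A ⟶ B` with quasi-inverse
`g` (`f ≫ g = [N]_A`): a rational `(2,2)`-class `c` on `A` has `g^* c` rational of type `(2,2)` on `B`, hence in
`D²(B) ⊗ ℂ + span {α^* w}`; pulling back by `f`, `f^*(D²(B) ⊗ ℂ) ⊆ D²(A) ⊗ ℂ` and `f^* α^* w = (f ≫ α)^* w` with
`f ≫ α` again a surjective homomorphism onto the fourfold; finally `f^* g^* c = N⁴ c`. (In this weak form no transport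
of a Weil structure is needed.) [cite: vanGeemen1994HodgeAV, 3.6–3.7] [cite: MumfordAV1970, §19 Remark p. 169]
[cite: MoonenZarhin1999LowDim, §5 (5.1)] -/
theorem IsCodimTwoDivisorPullbackGenerated.of_isIsogeny (hB : IsCodimTwoDivisorPullbackGenerated B) {f : A ⟶ B}
    (hf : AbelianVariety.IsIsogeny f) : IsCodimTwoDivisorPullbackGenerated A := by
  obtain ⟨g, N, hN, hfg, -⟩ := AbelianVariety.IsIsogeny.exists_nsmul_inverse_holds hf
  intro c hcQ hcH
  have hc' := AbelianVariety.mapsTo_hodgeClasses g 2 ⟨hcQ, hcH⟩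
  have hmem := hB _ hc'.1 hc'.2
  -- `f^*` maps the right-hand side at `B` into the right-hand side at `A`
  have hle : (divisorClassesSpan B.X B.dim 2 ⊔
      Submodule.span ℂ {w' : complexBetti B.X (2 * 2) |
        ∃ (B' : AbelianVariety ℂ) (α : B ⟶ B') (w : complexBetti B'.X (2 * 2)),
          B'.dim = 4 ∧ Surjective (AbelianVariety.Hom.toSchemeHom α) ∧
          IsRationalClass w ∧ IsOfHodgeType B'.dim B'.X (2 * 2) 2 2 w ∧
          w' = complexBetti.map α.hom.hom.hom (2 * 2) w}).map (complexBetti.map f.hom.hom.hom (2 * 2)).hom ≤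
      divisorClassesSpan A.X A.dim 2 ⊔
        Submodule.span ℂ {w' : complexBetti A.X (2 * 2) |
          ∃ (B' : AbelianVariety ℂ) (α : A ⟶ B') (w : complexBetti B'.X (2 * 2)),
            B'.dim = 4 ∧ Surjective (AbelianVariety.Hom.toSchemeHom α) ∧
            IsRationalClass w ∧ IsOfHodgeType B'.dim B'.X (2 * 2) 2 2 w ∧
            w' = complexBetti.map α.hom.hom.hom (2 * 2) w} := by
    rw [Submodule.map_sup]
    refine sup_le_sup ?_ ?_
    · rintro _ ⟨y, hy, rfl⟩
      exact AbelianVariety.map_mem_divisorClassesSpan f hy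
    · rw [Submodule.map_span, Submodule.span_le]
      rintro _ ⟨w', ⟨B', α, w, hB', hα, hwQ, hwH, rfl⟩, rfl⟩
      refine Submodule.subset_span ⟨B', f ≫ α, w, hB', ?_, hwQ, hwH, ?_⟩
      · haveI := hf.1
        haveI := hα
        rw [AbelianVariety.toSchemeHom_comp]
        infer_instance
      · exact abelianVarietyHom_map_map_apply f α w
  have hN4 := hle ⟨_, hmem, rfl⟩
  change complexBetti.map f.hom.hom.hom (2 * 2) (complexBetti.map g.hom.hom.hom (2 * 2) c) ∈ _ at hN4
  rw [complexBetti_map_map_of_comp_eq_nsmul_id hfg (2 * 2) c] at hN4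
  have hN' : ((N : ℂ) ^ (2 * 2)) ≠ 0 := pow_ne_zero _ (Nat.cast_ne_zero.2 hN.ne')
  have := Submodule.smul_mem _ (((N : ℂ) ^ (2 * 2))⁻¹) hN4
  rwa [smul_smul, inv_mul_cancel₀ hN', one_smul] at this

/-- **… AND TO THE TARGET** of an isogeny `f : B ⟶ A` (a quasi-inverse is an isogeny). [cite: vanGeemen1994HodgeAV, 3.6–3.7]
[cite: MumfordAV1970, §19 Remark p. 169] -/
theorem IsCodimTwoDivisorPullbackGenerated.of_isIsogeny' (hB : IsCodimTwoDivisorPullbackGenerated B) {f : B ⟶ A}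
    (hf : AbelianVariety.IsIsogeny f) : IsCodimTwoDivisorPullbackGenerated A := by
  obtain ⟨g, N, hN, hfg, hgf⟩ := AbelianVariety.IsIsogeny.exists_nsmul_inverse_holds hf
  have hg : AbelianVariety.IsIsogeny g :=
    AbelianVariety.isIsogeny_of_comp_eq_of_comp_eq
      (AbelianVariety.isIsogeny_nsmul_id_of_cast_ne_zero B N (Nat.cast_ne_zero.2 hN.ne'))
      (AbelianVariety.isIsogeny_nsmul_id_of_cast_ne_zero A N (Nat.cast_ne_zero.2 hN.ne')) hfg hgf
  exact hB.of_isIsogeny hg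

/-- `A ∼ B` form. [cite: vanGeemen1994HodgeAV, 3.6–3.7] [cite: MoonenZarhin1999LowDim, §5 (5.1)] -/
theorem IsCodimTwoDivisorPullbackGenerated.of_isIsogenous (hB : IsCodimTwoDivisorPullbackGenerated B)
    (hAB : AbelianVariety.IsIsogenous A B) : IsCodimTwoDivisorPullbackGenerated A := by
  obtain ⟨f, hf⟩ := hAB
  exact hB.of_isIsogeny hf

/-- `B ∼ A` form. [cite: vanGeemen1994HodgeAV, 3.6–3.7] [cite: MoonenZarhin1999LowDim, §5 (5.1)] -/
theorem IsCodimTwoDivisorPullbackGenerated.of_isIsogenous' (hB : IsCodimTwoDivisorPullbackGenerated B)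
    (hBA : AbelianVariety.IsIsogenous B A) : IsCodimTwoDivisorPullbackGenerated A := by
  obtain ⟨f, hf⟩ := hBA
  exact hB.of_isIsogeny' hf

/-- `B² ⊆ D² + Σ_α α^* B²(X')` for `A` iff for `B`, when `A ∼ B`. [cite: vanGeemen1994HodgeAV, Lemma 3.7] -/
theorem isCodimTwoDivisorPullbackGenerated_iff_of_isIsogenous (hAB : AbelianVariety.IsIsogenous A B) :
    IsCodimTwoDivisorPullbackGenerated A ↔ IsCodimTwoDivisorPullbackGenerated B :=
  ⟨fun h => h.of_isIsogenous' hAB, fun h => h.of_isIsogenous hAB⟩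

/-! ### §3 The Künneth row: a fourfold times an elliptic curve with product span ((5.3), (5.11), (5.12)) -/

/-- `pr_Y : Y × C ⟶ Y` is a surjective homomorphism (it has the section `(𝟙, 0)`). [folklore] -/
private theorem surjective_toSchemeHom_fst (Y C : AbelianVariety ℂ) :
    Surjective (AbelianVariety.Hom.toSchemeHom (AbelianVariety.fst Y C)) :=
  surjective_toSchemeHom_of_comp_eq_nsmul_id (AbelianVariety.prodLift (𝟙 Y) 0) (AbelianVariety.fst Y C)
    one_ne_zero (by rw [AbelianVariety.prodLift_fst, one_smul])

/-- **THE KÜNNETH ROW.** Let `Y` be a complex abelian FOURFOLD, `C` an elliptic curve, and suppose the rational Hodge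
classes of `Y × C` are spanned by exterior products `pr_Y^* a ∪ pr_C^* b` of rational Hodge classes of the factors
(`HodgeClassesProductSpan Y C` — «`Hg(X) = Hg(Y) × Hg(C)`» read on classes). Then `B²(Y × C) ⊆ D² + Σ_α α^* B²(X')`:
in `H⁴ = [H⁴(Y)⊗H⁰(C)] ⊕ [H²⊗H²] ⊕ [H⁰⊗H⁴] ⊕ (odd ⊗ odd)` (Moonen–Zarhin p0009 L28–L31, p0011 L20–L27) a generator with
`deg b = 0` is `b = t·1` (`H⁰(C) = ℂ·1`, `mem_divisorClassesSpan_zero`; `pr_C^* 1 = 1`, `a ∪ 1 = a`), i.e. a multiple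
of `pr_Y^* a`, the pull-back of a rational `(2,2)`-class of the fourfold `Y` along the surjective `pr_Y`; one with
`deg a = deg b = 2` is a product of two divisor classes (`mem_divisorClassesSpan_one`); one with `deg b = 4` vanishes
(`H⁴(C(ℂ); ℂ) = 0`, `2 dim C = 2 < 4`). [cite: MoonenZarhin1999LowDim, Thm. 0.2 and §5 (5.11), (5.12)]
[cite: HatcherAT2002, §3.2 Prop. 3.10 and p. 211] [cite: vanGeemen1994HodgeAV, §2.4] -/
theorem isCodimTwoDivisorPullbackGenerated_prod_curve_of_productSpan (hY : Y.dim = 4) (hC : C.dim = 1)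
    (hS : HodgeClassesProductSpan Y C) : IsCodimTwoDivisorPullbackGenerated (Y.prod C) := by
  have hCs : IsSmoothProjective C.dim C.X := AbelianVariety.isSmoothProjective_holds
  intro c hc hH
  rw [AbelianVariety.dim_prod] at hH
  refine (Submodule.span_le.2 ?_) (hS 2 c hc hH)
  rintro x ⟨l, k, hlk, a, b, ha, ha', hb, hb', rfl⟩
  have hl : l ≤ 2 := by omega
  interval_cases l
  · -- `(deg a, deg b) = (0, 4)`: `b ∈ H⁴(C(ℂ); ℂ) = 0`
    obtain rfl : k = 2 := by omega
    haveI := abelianVarietyCohomologyExteriorH1_holds.subsingleton_of_lt C (show 2 * C.dim < 2 * 2 by omega)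
    rw [Subsingleton.elim b 0, map_zero, map_zero]
    exact Submodule.zero_mem _
  · -- `(2, 2)`: a product of two divisor classes
    obtain rfl : k = 1 := by omega
    exact Submodule.mem_sup_left (cupProduct_mem_divisorClassesSpan_of_mem (by norm_num) hlk
      (AbelianVariety.map_mem_divisorClassesSpan (AbelianVariety.fst Y C) (mem_divisorClassesSpan_one ha ha'))
      (AbelianVariety.map_mem_divisorClassesSpan (AbelianVariety.snd Y C) (mem_divisorClassesSpan_one hb hb')))
  · -- `(4, 0)`: `b = t • 1`, `pr_Y^* a ∪ pr_C^* (t • 1) = t • pr_Y^* a`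
    obtain rfl : k = 0 := by omega
    have hb1 : b ∈ Submodule.span ℂ {singularCohomology.one ℂ (ComplexPoints C.X)} :=
      mem_divisorClassesSpan_zero (N := C.dim) hCs b
    obtain ⟨t, rfl⟩ := Submodule.mem_span_singleton.1 hb1
    rw [map_smul, map_smul]
    refine Submodule.smul_mem _ t (Submodule.mem_sup_right (Submodule.subset_span
      ⟨Y, AbelianVariety.fst Y C, a, hY, surjective_toSchemeHom_fst Y C, ha, ha', ?_⟩))
    have h1 : complexBetti.map (snd Y.X C.X) (2 * 0) (singularCohomology.one ℂ (ComplexPoints C.X)) =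
        singularCohomology.one ℂ (ComplexPoints (Y.X ⊗ C.X)) :=
      singularCohomology.map_one _
    rw [h1]
    exact cupProduct_one _

/-- The same with the curve FIRST: `HodgeClassesProductSpan C Y` gives the predicate for `C × Y`
(`HodgeClassesProductSpan.symm` and `C × Y ∼ Y × C`). [cite: MoonenZarhin1999LowDim, Thm. 0.2 and §5 (5.12)] -/
theorem isCodimTwoDivisorPullbackGenerated_curve_prod_of_productSpan (hC : C.dim = 1) (hY : Y.dim = 4)
    (hS : HodgeClassesProductSpan C Y) : IsCodimTwoDivisorPullbackGenerated (C.prod Y) :=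
  (isCodimTwoDivisorPullbackGenerated_prod_curve_of_productSpan hY hC hS.symm).of_isIsogenous
    (isIsogenous_prod_swap C Y)

/-! ### §4 The rows of Thm. 0.2 the tree has proved: case (f), and a simple fourfold times an elliptic curve -/

/-- **CASE (f) (Thm. 0.2 (2)).** `X₀`, `X₁` elliptic curves, `X₀ ≁ X₁`, `χ₁ ≫ χ₁ = -d₁` on `X₁` (`d₁ > 0`), `X₂` a
simple threefold, `j : End⁰(X₁) →+* End⁰(X₂)` («an embedding `k ↪ End⁰(X_2)`»): then
`B²(X₀ × (X₁ × X₂)) ⊆ D² + Σ_α α^* B²(X')`. The tree's R33-B product span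
`hodgeClassesProductSpan_caseF_of_dim_eq_three` («`Hg(X) = Hg(X_0) × Hg(X_1 × X_2)`», (5.9), (5.11)), fed with an honest
`φ : X₂ ⟶ X₂`, `φ ≫ φ = -(M²d₁) = (Mχ₁) ≫ (Mχ₁)` produced from `j` (`exists_hom_comp_self_eq_neg_of_ringHom`), and §3
for the fourfold `X₁ × X₂` — NO Weil-class input is needed for the weak form («Case (f) is easy», (5.12)).
[cite: MoonenZarhin1999LowDim, Thm. 0.2 (2) with case (f) and §5 (5.12)] -/
theorem isCodimTwoDivisorPullbackGenerated_caseF (hX₀ : X₀.dim = 1) (hX₁ : X₁.dim = 1)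
    (hni : ¬ AbelianVariety.IsIsogenous X₀ X₁) (χ₁ : X₁ ⟶ X₁) {d₁ : ℕ} (hd₁ : 0 < d₁)
    (hχ₁ : χ₁ ≫ χ₁ = -(d₁ • 𝟙 X₁)) (hX₂ : X₂.IsSimple) (hX₂3 : X₂.dim = 3) (j : X₁.endAlgebra →+* X₂.endAlgebra) :
    IsCodimTwoDivisorPullbackGenerated (X₀.prod (X₁.prod X₂)) := by
  obtain ⟨φ, M, hM, hφ, hχM, -⟩ := exists_hom_comp_self_eq_neg_of_ringHom hχ₁ j
  exact isCodimTwoDivisorPullbackGenerated_curve_prod_of_productSpan hX₀ (by rw [AbelianVariety.dim_prod]; omega)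
    (hodgeClassesProductSpan_caseF_of_dim_eq_three hX₀ hX₁ hni (M • χ₁) (Nat.mul_pos (pow_pos hM 2) hd₁) hχM hX₂
      hX₂3 φ hφ)

/-- **CASE (f) EXACTLY AS PRINTED: every `X` isogenous to `X₀ × X₁ × X₂`** with `X₁` an elliptic curve of CM type
(`IsOfCMType X₁`), `X₀ ≁ X₁` an elliptic curve, `X₂` a simple threefold and `Nonempty (End⁰(X₁) →+* End⁰(X₂))`
satisfies `B²(X) ⊆ D²(X) + Σ_α α^* B²(X')` — UNCONDITIONALLY. [cite: MoonenZarhin1999LowDim, Thm. 0.2 (2) with case (f)]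
[cite: vanGeemen1994HodgeAV, Lemma 3.7] -/
theorem isCodimTwoDivisorPullbackGenerated_of_isIsogenous_caseF (hX : AbelianVariety.IsIsogenous X (X₀.prod (X₁.prod X₂)))
    (hX₀ : X₀.dim = 1) (hX₁ : X₁.dim = 1) (hX₁cm : IsOfCMType X₁) (hni : ¬ AbelianVariety.IsIsogenous X₀ X₁)
    (hX₂ : X₂.IsSimple) (hX₂3 : X₂.dim = 3) (hj : Nonempty (X₁.endAlgebra →+* X₂.endAlgebra)) :
    IsCodimTwoDivisorPullbackGenerated X := by
  obtain ⟨j⟩ := hj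
  obtain ⟨χ₁, d₁, hd₁, hχ₁⟩ := exists_hom_comp_self_eq_neg_of_cmCurve hX₁ hX₁cm
  exact (isCodimTwoDivisorPullbackGenerated_caseF hX₀ hX₁ hni χ₁ hd₁ hχ₁ hX₂ hX₂3 j).of_isIsogenous hX

/-- Homomorphisms from a simple abelian variety onto one of smaller positive… — here: every homomorphism `Y ⟶ C` from
a SIMPLE `Y` to a `C` of smaller dimension vanishes (a non-zero `C ⟶ Y` would force `dim Y ≤ dim C`, and
`Hom(C, Y) = 0 ⟺ Hom(Y, C) = 0`). [cite: MumfordAV1970, §19 Cor. 2 of Thm. 1 (p. 174)] -/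
theorem forall_hom_eq_zero_of_isSimple_of_dim_lt (hYs : Y.IsSimple) (h : C.dim < Y.dim) : ∀ u : Y ⟶ C, u = 0 := by
  refine Literature.AlgebraicGeometry.HodgeTheory.AbelianVariety.forall_hom_eq_zero_comm.1 fun f => ?_
  by_contra hf
  have := AbelianVariety.dim_le_of_isSimple_of_ne_zero f hYs hf
  omega

/-- **`Y × C` for `Y` a FOURFOLD and `C` an elliptic curve with `End⁰(C) = ℚ` and `Hom(Y, C) = 0`** (Lemma (3.4) with
(3.1): product span, the tree's `hodgeClassesProductSpan_of_lowGeneric_of_forall_hom_eq_zero`) satisfies the predicate.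
[cite: MoonenZarhin1999LowDim, §3 (3.1) and Lemma (3.4)] -/
theorem isCodimTwoDivisorPullbackGenerated_fourfold_prod_curve_of_finrank_eq_one (hY : Y.dim = 4) (hC : C.dim = 1)
    (hCend : Module.finrank ℚ C.endAlgebra = 1) (hYC : ∀ u : Y ⟶ C, u = 0) :
    IsCodimTwoDivisorPullbackGenerated (Y.prod C) :=
  isCodimTwoDivisorPullbackGenerated_prod_curve_of_productSpan hY hC
    (hodgeClassesProductSpan_of_lowGeneric_of_forall_hom_eq_zero (by omega) (by omega) hCend hYC)

/-- **`Y × C` for `Y` a SIMPLE FOURFOLD and `C` an elliptic curve with `χ ≫ χ = -d'`, under BALANCED CENTRAL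
MULTIPLICITIES** — every central `φ : Y ⟶ Y` with `φ ≫ φ = -(M²d')` has equal multiplicities of `± iM√d'` on
`H^{1,0}(Y)` (in particular: no such `φ`, «no embedding of `k` into the centre», or `k` acting `(2,2)`, (5.11) Case 1)
— satisfies the predicate: product span by Prop. (3.8), the tree's R31-B
`hodgeClassesProductSpan_of_isSimple_cmCurve_of_balanced`. [cite: MoonenZarhin1999LowDim, §3 Prop. (3.8) and §5 (5.11)] -/
theorem isCodimTwoDivisorPullbackGenerated_simpleFourfold_prod_cmCurve_of_balanced (hYs : Y.IsSimple) (hY : Y.dim = 4)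
    (hC : C.dim = 1) (χ : C ⟶ C) {d' : ℕ} (hd' : 0 < d') (hχ : χ ≫ χ = -(d' • 𝟙 C))
    (hbal : ∀ (φ : Y ⟶ Y) (M : ℕ), 0 < M → φ ≫ φ = -((M * M * d') • 𝟙 Y) →
      AbelianVariety.endAlgebra.of Y φ ∈ Subalgebra.center ℚ Y.endAlgebra →
      eigenMultiplicity Y φ (Complex.I * (Real.sqrt (M * M * d' : ℕ) : ℂ)) =
        eigenMultiplicity Y φ (-(Complex.I * (Real.sqrt (M * M * d' : ℕ) : ℂ)))) :
    IsCodimTwoDivisorPullbackGenerated (Y.prod C) :=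
  isCodimTwoDivisorPullbackGenerated_prod_curve_of_productSpan hY hC
    (hodgeClassesProductSpan_of_isSimple_cmCurve_of_balanced hYs (by omega) hC χ hd' hχ hbal)

/-- **CASE (g) WITH `End⁰(Y) = k` (Thm. 0.2 (3)): `Y × C` for `Y` a fourfold with `dim_ℚ End⁰(Y) = 2`, `φ ≫ φ = -d`
of multiplicity `1` at `± i√d`, and `C` an elliptic curve with `χ ≫ χ = -d'`** has `B = D` (the tree's R29
`isDivisorGenerated_prod_cmCurve_of_unitaryTypeOne`), hence satisfies the predicate.
[cite: MoonenZarhin1999LowDim, Thm. 0.2 (3) with case (g) and §5 (5.11) Case 2] -/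
theorem isCodimTwoDivisorPullbackGenerated_fourfold_prod_cmCurve_of_unitaryTypeOne (hY : Y.dim = 4)
    (hY2 : Module.finrank ℚ Y.endAlgebra = 2) (φ : Y ⟶ Y) {d : ℕ} (hd : 0 < d) (hφ : φ ≫ φ = -(d • 𝟙 Y))
    (hm1 : eigenMultiplicity Y φ (Complex.I * (Real.sqrt d : ℂ)) = 1 ∨
      eigenMultiplicity Y φ (-(Complex.I * (Real.sqrt d : ℂ))) = 1)
    (hC : C.dim = 1) (χ : C ⟶ C) {d' : ℕ} (hd' : 0 < d') (hχ : χ ≫ χ = -(d' • 𝟙 C)) :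
    IsCodimTwoDivisorPullbackGenerated (Y.prod C) :=
  (isDivisorGenerated_prod_cmCurve_of_unitaryTypeOne (by omega) hY2 φ hd hφ hm1 hC χ hd' hχ).isCodimTwoDivisorPullbackGenerated

/-- **A SIMPLE FOURFOLD TIMES AN ELLIPTIC CURVE: `B²(Y × C) ⊆ D² + Σ_α α^* B²(X')` OUTSIDE THE RESIDUAL OF CASE (g).**
Hypothesis `hres` (the only thing excluded): whenever `C` has complex multiplication `χ ≫ χ = -d'` and `Y` carries a
CENTRAL `φ` with `φ ≫ φ = -(M²d')` of UNBALANCED multiplicities — on a simple fourfold necessarily `(1,3)`/`(3,1)`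
(Shimura, the tree's `AbelianVariety.eigenMultiplicity_pos_of_isSimple`), i.e. «`k ↪ End⁰(X₂)` acting with
multiplicities `(1,3)`», case (g) — then `dim_ℚ End⁰(Y) = 2` (`End⁰(Y) = k`). Proof: `C` not of CM type ⟹
`End⁰(C) = ℚ` (`finrank_endAlgebra_eq_one_of_curve_of_not_isOfCMType`) and `Hom(Y, C) = 0`, Lemma (3.4); `C` of CM
type and balanced ⟹ Prop. (3.8); unbalanced ⟹ `hres`, case (g) with `End⁰ = k`, `B = D`.
[cite: MoonenZarhin1999LowDim, Thm. 0.2 (3)–(4), §3 Lemma (3.4), Prop. (3.8), §5 (5.11)] [cite: Milne1999, §2 p. 54] -/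
theorem isCodimTwoDivisorPullbackGenerated_simpleFourfold_prod_curve (hYs : Y.IsSimple) (hY : Y.dim = 4)
    (hC : C.dim = 1)
    (hres : ∀ (χ : C ⟶ C) (d' : ℕ), 0 < d' → χ ≫ χ = -(d' • 𝟙 C) → ∀ (φ : Y ⟶ Y) (M : ℕ), 0 < M →
      φ ≫ φ = -((M * M * d') • 𝟙 Y) → AbelianVariety.endAlgebra.of Y φ ∈ Subalgebra.center ℚ Y.endAlgebra →
      eigenMultiplicity Y φ (Complex.I * (Real.sqrt (M * M * d' : ℕ) : ℂ)) ≠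
        eigenMultiplicity Y φ (-(Complex.I * (Real.sqrt (M * M * d' : ℕ) : ℂ))) →
      Module.finrank ℚ Y.endAlgebra = 2) :
    IsCodimTwoDivisorPullbackGenerated (Y.prod C) := by
  by_cases hCcm : IsOfCMType C
  · obtain ⟨χ, d', hd', hχ⟩ := exists_hom_comp_self_eq_neg_of_cmCurve hC hCcm
    by_cases hbal : ∀ (φ : Y ⟶ Y) (M : ℕ), 0 < M → φ ≫ φ = -((M * M * d') • 𝟙 Y) →
        AbelianVariety.endAlgebra.of Y φ ∈ Subalgebra.center ℚ Y.endAlgebra →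
        eigenMultiplicity Y φ (Complex.I * (Real.sqrt (M * M * d' : ℕ) : ℂ)) =
          eigenMultiplicity Y φ (-(Complex.I * (Real.sqrt (M * M * d' : ℕ) : ℂ)))
    · exact isCodimTwoDivisorPullbackGenerated_simpleFourfold_prod_cmCurve_of_balanced hYs hY hC χ hd' hχ hbal
    · simp only [not_forall, exists_prop] at hbal
      obtain ⟨φ, M, hM, hφ, hφZ, hne⟩ := hbal
      have hdM : 0 < M * M * d' := Nat.mul_pos (Nat.mul_pos hM hM) hd'
      have h2 : Module.finrank ℚ Y.endAlgebra = 2 := hres χ d' hd' hχ φ M hM hφ hφZ hne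
      have hsum := eigenMultiplicity_add_eigenMultiplicity_neg_eq_dim Y φ hdM hφ
      rw [hY] at hsum
      obtain ⟨ha, hb⟩ := AbelianVariety.eigenMultiplicity_pos_of_isSimple Y hYs φ hdM hφ (by omega)
      have hm1 : eigenMultiplicity Y φ (Complex.I * (Real.sqrt (M * M * d' : ℕ) : ℂ)) = 1 ∨
          eigenMultiplicity Y φ (-(Complex.I * (Real.sqrt (M * M * d' : ℕ) : ℂ))) = 1 := by omega
      exact isCodimTwoDivisorPullbackGenerated_fourfold_prod_cmCurve_of_unitaryTypeOne hY h2 φ hdM hφ hm1 hC χ hd' hχ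
  · exact isCodimTwoDivisorPullbackGenerated_fourfold_prod_curve_of_finrank_eq_one hY hC
      (finrank_endAlgebra_eq_one_of_curve_of_not_isOfCMType hC hCcm)
      (forall_hom_eq_zero_of_isSimple_of_dim_lt hYs (by omega))

/-- … **and for every `X` isogenous to such a `Y × C`.** [cite: MoonenZarhin1999LowDim, Thm. 0.2 (3)–(4)]
[cite: vanGeemen1994HodgeAV, Lemma 3.7] -/
theorem isCodimTwoDivisorPullbackGenerated_of_isIsogenous_simpleFourfold_prod_curve
    (hX : AbelianVariety.IsIsogenous X (Y.prod C)) (hYs : Y.IsSimple) (hY : Y.dim = 4) (hC : C.dim = 1)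
    (hres : ∀ (χ : C ⟶ C) (d' : ℕ), 0 < d' → χ ≫ χ = -(d' • 𝟙 C) → ∀ (φ : Y ⟶ Y) (M : ℕ), 0 < M →
      φ ≫ φ = -((M * M * d') • 𝟙 Y) → AbelianVariety.endAlgebra.of Y φ ∈ Subalgebra.center ℚ Y.endAlgebra →
      eigenMultiplicity Y φ (Complex.I * (Real.sqrt (M * M * d' : ℕ) : ℂ)) ≠
        eigenMultiplicity Y φ (-(Complex.I * (Real.sqrt (M * M * d' : ℕ) : ℂ))) →
      Module.finrank ℚ Y.endAlgebra = 2) :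
    IsCodimTwoDivisorPullbackGenerated X :=
  (isCodimTwoDivisorPullbackGenerated_simpleFourfold_prod_curve hYs hY hC hres).of_isIsogenous hX

end Literature.AlgebraicGeometry.HodgeTheory

end
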